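import Literature.Analysis.SpecialFunctions.PolygammaSeries
import Literature.NumberTheory.LFunctions.ClassGroupLFunctionLogDerivLeft
import Literature.NumberTheory.LFunctions.ZetaZerosReflection
import HarnessLib

/-!
# Higher derivatives of `γ_K'/γ_K` for the gamma factor `γ_K = |d_K|^{s/2} Γ_ℝ^{r₁} Γ_ℂ^{r₂}` of `ζ_K`

Topic `Literature/NumberTheory/LFunctions` (namespace `Literature.NumberTheory.LFunctions.NumberField`),
continuing `ClassGroupLFunctionLogDerivLeft.lean` (`logDeriv_dedekindGammaFactor`:
`γ'/γ = ½ log|d_K| + r₁ Γ_ℝ'/Γ_ℝ + r₂ Γ_ℂ'/Γ_ℂ`, `logDeriv_Gammaℂ`) and the polygamma series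
`Literature.Analysis.SpecialFunctions.Complex.hasSum_iteratedDeriv_digamma{,_half}`.  Everything here is PROVED.

* `hasSum_iteratedDeriv_logDeriv_dedekindGammaFactor` — for `0 < Re s` and `k ≥ 1`,
  `(γ_K'/γ_K)^{(k)}(s) = (−1)^{k+1} k! ∑_{j ≥ 0} ( r₁ (s + 2j)^{−(k+1)} + r₂ (s + j)^{−(k+1)} )`.

These are the "trivial zeros, counted with multiplicity" terms of the explicit formula for the higher
derivatives of `−L'/L(s, χ)` for the `L`-functions of class group characters (all of which have the
gamma factor `γ_K`): poles of `Γ_ℝ(s)^{r₁}Γ_ℂ(s)^{r₂}` at `s = −2j` with multiplicity `r₁ + r₂` and at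
`s = −(2j+1)` with multiplicity `r₂` [cite: ThornerZaman2017, §2 (2.4), §7 Lemma 7.3].

## References

* J. Thorner, A. Zaman, *An explicit bound for the least prime ideal in the Chebotarev density
  theorem*, Algebra Number Theory 11 (2017), §2, §7. [ThornerZaman2017]
* G. E. Andrews, R. Askey, R. Roy, *Special Functions*, CUP 1999, Thm. 1.2.5. [AndrewsAskeyRoy1999]
-/

noncomputable section

open scoped NumberField Real
open NumberField NumberField.InfinitePlace Complex Filter Topology Set

namespace Literature.NumberTheory.LFunctions.NumberField

open Literature.Analysis.SpecialFunctions.Complex (hasSum_iteratedDeriv_digamma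
  hasSum_iteratedDeriv_digamma_half differentiableOn_digamma)

variable (K : Type*) [Field K] [NumberField K]

omit [NumberField K] in
/-- `ψ` is `C^k` at every point of the right half-plane. [folklore] -/
theorem contDiffAt_digamma {z : ℂ} (hz : 0 < z.re) (k : ℕ) : ContDiffAt ℂ k digamma z :=
  (differentiableOn_digamma.analyticAt
    ((isOpen_lt continuous_const continuous_re).mem_nhds hz)).contDiffAt

omit [NumberField K] in
/-- `z ↦ ψ(z/2)/2` is `C^k` at every point of the right half-plane. [folklore] -/
theorem contDiffAt_digamma_half {z : ℂ} (hz : 0 < z.re) (k : ℕ) :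
    ContDiffAt ℂ k (fun w ↦ digamma (w / 2) / 2) z := by
  have hU : IsOpen {w : ℂ | 0 < w.re} := isOpen_lt continuous_const continuous_re
  have hd : DifferentiableOn ℂ (fun w ↦ digamma (w / 2) / 2) {w : ℂ | 0 < w.re} := by
    intro w hw
    have hw2 : 0 < (w / 2).re := by simp at hw ⊢; linarith
    have h1 : DifferentiableAt ℂ digamma (w / 2) :=
      (differentiableOn_digamma (w / 2) hw2).differentiableAt (hU.mem_nhds hw2)
    exact ((h1.comp w (differentiableAt_id.div_const 2)).div_const 2).differentiableWithinAt
  exact (hd.analyticAt (hU.mem_nhds hz)).contDiffAt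

/-- **Higher derivatives of `γ_K'/γ_K`**: for `0 < Re s` and `k ≥ 1`,
`(γ_K'/γ_K)^{(k)}(s) = (−1)^{k+1} k! ∑_{j≥0} ( r₁ (s + 2j)^{−(k+1)} + r₂ (s + j)^{−(k+1)} )`.
[cite: ThornerZaman2017, §2 (2.4)] [cite: AndrewsAskeyRoy1999, Thm 1.2.5 (1.2.14)] -/
theorem hasSum_iteratedDeriv_logDeriv_dedekindGammaFactor {s : ℂ} (hs : 0 < s.re) {k : ℕ}
    (hk : 1 ≤ k) :
    HasSum (fun j : ℕ ↦ (-1) ^ (k + 1) * (k.factorial : ℂ) *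
        ((nrRealPlaces K : ℂ) * ((s + 2 * j) ^ (k + 1))⁻¹ +
          (nrComplexPlaces K : ℂ) * ((s + j) ^ (k + 1))⁻¹))
      (iteratedDeriv k (logDeriv (dedekindGammaFactor K)) s) := by
  have hU : IsOpen {w : ℂ | 0 < w.re} := isOpen_lt continuous_const continuous_re
  -- `γ'/γ = C + r₁ ψ(·/2)/2 + r₂ ψ` on the right half-plane
  set C : ℂ := Complex.log ((discr K).natAbs : ℂ) / 2 + (nrRealPlaces K : ℂ) * (-(Complex.log π) / 2) +
    (nrComplexPlaces K : ℂ) * (-Complex.log (2 * π)) with hC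
  have hev : logDeriv (dedekindGammaFactor K) =ᶠ[𝓝 s] fun z ↦
      C + ((nrRealPlaces K : ℂ) * (digamma (z / 2) / 2) + (nrComplexPlaces K : ℂ) * digamma z) := by
    filter_upwards [hU.mem_nhds hs] with z hz
    have hz' : ∀ m : ℕ, z ≠ -m := ne_neg_nat_of_re_pos hz
    have hz2 : ∀ m : ℕ, z / 2 ≠ -m :=
      ne_neg_nat_of_re_pos (by simp at hz ⊢; linarith)
    rw [logDeriv_dedekindGammaFactor hz', LFunctions.logDeriv_Gammaℝ hz2, logDeriv_Gammaℂ hz', hC]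
    ring
  have hk0 : 0 < k := hk
  have h1 : ContDiffAt ℂ k (fun z ↦ (nrRealPlaces K : ℂ) * (digamma (z / 2) / 2)) s :=
    contDiffAt_const.mul (contDiffAt_digamma_half hs k)
  have h2 : ContDiffAt ℂ k (fun z ↦ (nrComplexPlaces K : ℂ) * digamma z) s :=
    contDiffAt_const.mul (contDiffAt_digamma hs k)
  rw [hev.iteratedDeriv_eq, iteratedDeriv_const_add hk0, iteratedDeriv_fun_add h1 h2,
    iteratedDeriv_const_mul _ (contDiffAt_digamma_half hs k),
    iteratedDeriv_const_mul _ (contDiffAt_digamma hs k)]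
  have hA := (hasSum_iteratedDeriv_digamma_half hs hk).mul_left (nrRealPlaces K : ℂ)
  have hB := (hasSum_iteratedDeriv_digamma hs hk).mul_left (nrComplexPlaces K : ℂ)
  refine (hA.add hB).congr_fun fun j ↦ ?_
  ring

end Literature.NumberTheory.LFunctions.NumberField

end
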